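import Literature.MathematicalPhysics.QuantumChemistry.SubsystemSectorConstraints
import HarnessLib

/-!
# A group-local second-quantised operator is bounded, occupation class by occupation class, by the
# sum of its LOCAL occupation-resolved tops (tensor-block spectrum lemma)

Topic `Literature/MathematicalPhysics/QuantumChemistry`. HONEST FRAMING: certified bounds for a stated
model Hamiltonian in a stated basis; not a claim about the real molecule or material beyond that model —
this file is finite-dimensional linear algebra on the second-quantised Fock space of the tree and
certifies no number. WHAT THIS FILE IS NOT: not a statement about any semidefinite programme, not a
bound on any pinned file, not a spectral theorem for commuting families (only OCCUPATION labels, which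
are diagonal in the occupation basis, are resolved here).

Companion (the UPPER twin) of `SubsystemSectorConstraints.lean` (B. Verstichel, H. van Aggelen,
D. Van Neck, P. W. Ayers, P. Bultinck, J. Chem. Phys. 132 (2010) 114113, §2.3: slicing a Fock vector
along a subset of orbitals, "a state with `j` particles in the Fock space generated by the subsystem
orbitals", eqs. (16)–(24)) and of `SubsystemSlices.lean`. There the sector ground energies of a
sub-Hamiltonian bound the embedded operator from BELOW, weighted by the subsystem-occupation weights
`w_ab(ψ)`; HERE per-sector UPPER form bounds `U(a, b)` of an arbitrary sector-preserving operator `A`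
on the subsystem Fock space bound the embedded operator `jwEmbed (orbEmb φ) A` from ABOVE with the same
weights (`re_form_jwEmbed_le_sum_subsectorWeight`), and on a vector supported on ONE subsystem
occupation class `N` only `U(N)` survives (`re_form_jwEmbed_le_of_occupation`). Summing over a
PARTITION of the orbitals into groups (`molecularHamiltonian_eq_sum_groups`: a spin-free Hamiltonian
whose integral tables are group-LOCAL — `h_pq ≠ 0 ⇒ p ~ q`, `(pq|rs) ≠ 0 ⇒ p ~ q ~ r ~ s` — is the
scalar plus the sum of the Jordan–Wigner embeddings of its restrictions to the groups) gives the
**tensor-block spectrum lemma** `groupLocal_form_le`: on every joint occupation class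
`l = (N_i)_i` of the groups, `Re⟨z, Ĥ(h, g, c) z⟩ ≤ (Re c + Σ_i U_i(l_i)) ‖z‖²`, where `U_i(N)` is
ANY upper bound of the quadratic form of the group-`i` restriction on the `N`-particle sectors of the
GROUP'S OWN Fock space (a `4^{|group i|}`-dimensional statement, blocks of size `≤ C(2|group i|, N)`).

Use (cell chem-oracle, door M1-OS, chem-idea-1 HYPOTHESES-M1OS.md (n2a)–(n2d) and
`solver/gap-temple/runs/blockcheck-exact/README.md` §4 «the Lean discharge of hoff (tensor-block
spectrum lemma) is a separate typed item»): the per-occupation-class premise `hoff` of the block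
deflator lemma `deflator_form_le_on_singlet_orth` (`SymmetricDeflation.lean`) — a statement over
occupation classes of dimension `~10⁸` at `k = 16` — follows from two LOCAL tables of nine numbers
each plus a finite occupation table (`Summits/…/Rows/SingletDeflatorLocalRows.lean`).

Everything is PROVED (0 sorry, no new definition): `molecularHamiltonian_eq_jwEmbed_of_support`,
`star_dotProduct_jwEmbed_mulVec`, `star_dotProduct_mulVec_eq_sum_sum_sectorProj`,
`sum_re_star_dotProduct_sectorProj_slice`, `sum_subsectorWeight` do the work. In-house linear
algebra; the cited places are the provenance of the MECHANISM (slicing along a subset of orbitals;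
the variational principle sector by sector), not restated facts.

## References
* B. Verstichel, H. van Aggelen, D. Van Neck, P. W. Ayers, P. Bultinck, *Subsystem constraints in
  variational second order density matrix optimization: Curing the dissociative behavior*, J. Chem.
  Phys. 132 (2010) 114113, arXiv:0910.4094, §2.3 eqs. (16)–(24). [VerstichelEtAl2010Subsystem]
* O. Bratteli, D. W. Robinson, *Operator Algebras and Quantum Statistical Mechanics 2* (1997), §5.2.1–
  5.2.2 (Fock space of a direct sum; isotony of the local CAR algebras). [BratteliRobinsonII1997]
* H. Tasaki, *Physics and Mathematics of Quantum Many-Body Systems* (2020), §2.2 (variational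
  characterisation sector by sector). [Tasaki2020]
* T. Helgaker, P. Jørgensen, J. Olsen, *Molecular Electronic-Structure Theory* (2000), eq. (2.2.18)
  (the second-quantised Hamiltonian of an integral table). [HelgakerJorgensenOlsen2000]
-/

noncomputable section

namespace Literature.MathematicalPhysics.QuantumChemistry

open Matrix Finset Literature.MathematicalPhysics.QuantumLattice JWEmbed
open scoped ComplexOrder BigOperators

/-! ### 1. The UPPER twin of the subsystem constraint: local sector tops bound the embedded operator -/

section Subsystem

variable {Λ Λ' : Type*} [LinearOrder Λ] [Fintype Λ] [LinearOrder Λ'] [Fintype Λ']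
variable (φ : Λ ↪o Λ')

/-- **Local sector-resolved UPPER bounds pass to the embedded operator.** For an operator `A` on the
subsystem Fock space mapping every `(N_α, N_β)` sector into itself and numbers `U(a, b)` with
`Re⟨χ, Aχ⟩ ≤ U(a, b)·‖χ‖²` for every `χ` of the `(a, b)` sector of the SUBSYSTEM space, and every
vector `ψ` of the full Fock space,
`Re⟨ψ, (jwEmbed (orbEmb φ) A) ψ⟩ ≤ Σ_{a,b ≤ |Λ|} U(a, b) · w_ab(ψ)` (`w_ab = subsectorWeight`, the
weight of the subsystem occupation `(a, b)`). The upper twin of `subsystem_sector_constraint`: slice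
`ψ` along the environment configurations (Verstichel et al. (2010) §2.3 eqs. (16)–(19)), split each
slice into its sectors, bound sector by sector. [cite: VerstichelEtAl2010Subsystem, §2.3 eqs. (16)-(24)] -/
theorem re_form_jwEmbed_le_sum_subsectorWeight {A : Matrix (Finset (Orb Λ)) (Finset (Orb Λ)) ℂ}
    (hA : ∀ a b (χ : Fock (Orb Λ)), IsInSector a b χ → IsInSector a b (A *ᵥ χ)) (U : ℕ → ℕ → ℝ)
    (hU : ∀ a b (χ : Fock (Orb Λ)), IsInSector a b χ →
      (star χ ⬝ᵥ A *ᵥ χ).re ≤ U a b * (star χ ⬝ᵥ χ).re)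
    (ψ : Fock (Orb Λ')) :
    (star ψ ⬝ᵥ jwEmbed (orbEmb φ) A *ᵥ ψ).re ≤
      ∑ a ∈ Finset.range (Fintype.card Λ + 1), ∑ b ∈ Finset.range (Fintype.card Λ + 1),
        U a b * subsectorWeight φ ψ a b := by
  set e := orbEmb φ with he
  set R := Finset.range (Fintype.card Λ + 1) with hR
  calc (star ψ ⬝ᵥ jwEmbed e A *ᵥ ψ).re
      = ∑ K : Finset (Orb Λ'), (star ((frozenEmbed e K)ᴴ *ᵥ ψ) ⬝ᵥ A *ᵥ ((frozenEmbed e K)ᴴ *ᵥ ψ)).re := by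
        rw [star_dotProduct_jwEmbed_mulVec e, Complex.re_sum]
    _ ≤ ∑ K : Finset (Orb Λ'), ∑ a ∈ R, ∑ b ∈ R, U a b *
          (star (sectorProj a b ((frozenEmbed e K)ᴴ *ᵥ ψ)) ⬝ᵥ
            sectorProj a b ((frozenEmbed e K)ᴴ *ᵥ ψ)).re := by
        refine Finset.sum_le_sum fun K _ => ?_
        rw [star_dotProduct_mulVec_eq_sum_sum_sectorProj hA _, Complex.re_sum]
        refine Finset.sum_le_sum fun a _ => ?_
        rw [Complex.re_sum]
        exact Finset.sum_le_sum fun b _ => hU a b _ (isInSector_sectorProj a b _)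
    _ = ∑ a ∈ R, ∑ K : Finset (Orb Λ'), ∑ b ∈ R, U a b *
          (star (sectorProj a b ((frozenEmbed e K)ᴴ *ᵥ ψ)) ⬝ᵥ
            sectorProj a b ((frozenEmbed e K)ᴴ *ᵥ ψ)).re := Finset.sum_comm
    _ = ∑ a ∈ R, ∑ b ∈ R, ∑ K : Finset (Orb Λ'), U a b *
          (star (sectorProj a b ((frozenEmbed e K)ᴴ *ᵥ ψ)) ⬝ᵥ
            sectorProj a b ((frozenEmbed e K)ᴴ *ᵥ ψ)).re :=
        Finset.sum_congr rfl fun a _ => Finset.sum_comm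
    _ = ∑ a ∈ R, ∑ b ∈ R, U a b * subsectorWeight φ ψ a b := by
        refine Finset.sum_congr rfl fun a _ => Finset.sum_congr rfl fun b _ => ?_
        rw [← Finset.mul_sum, sum_re_star_dotProduct_sectorProj_slice]

/-- The weight of a subsystem occupation `(a, b)` vanishes on a vector supported on configurations with
exactly `N ≠ a + b` subsystem spin orbitals (`w_ab` sums `|ψ u'|²` over configurations with `a` up and
`b` down subsystem orbitals, Verstichel et al. (2010) eqs. (19)–(21)).
[cite: VerstichelEtAl2010Subsystem, §2.3 eqs. (19)-(21)] -/
theorem subsectorWeight_eq_zero_of_occupation {ψ : Fock (Orb Λ')} {N : ℕ}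
    (hψ : ∀ u', (upPart (pre (orbEmb φ) u')).card + (downPart (pre (orbEmb φ) u')).card ≠ N → ψ u' = 0)
    {a b : ℕ} (hab : a + b ≠ N) : subsectorWeight φ ψ a b = 0 := by
  unfold subsectorWeight
  refine Finset.sum_eq_zero fun u' hu' => ?_
  obtain ⟨-, ha, hb⟩ := Finset.mem_filter.1 hu'
  rw [hψ u' (by rw [ha, hb]; exact hab), norm_zero, zero_pow two_ne_zero]

/-- **Occupation-class form of the upper twin.** If `Re⟨χ, Aχ⟩ ≤ U(a + b)·‖χ‖²` on every `(a, b)` sector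
of the subsystem space (a bound resolved by the subsystem PARTICLE NUMBER only) and `ψ` is supported on
configurations carrying exactly `N` subsystem spin orbitals, then
`Re⟨ψ, (jwEmbed (orbEmb φ) A) ψ⟩ ≤ U(N)·‖ψ‖²` (only the weights with `a + b = N` survive and they sum
to `‖ψ‖²`, Verstichel et al. (2010) eq. (21)). [cite: VerstichelEtAl2010Subsystem, §2.3 eqs. (16)-(24)] -/
theorem re_form_jwEmbed_le_of_occupation {A : Matrix (Finset (Orb Λ)) (Finset (Orb Λ)) ℂ}
    (hA : ∀ a b (χ : Fock (Orb Λ)), IsInSector a b χ → IsInSector a b (A *ᵥ χ)) (U : ℕ → ℝ)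
    (hU : ∀ a b (χ : Fock (Orb Λ)), IsInSector a b χ →
      (star χ ⬝ᵥ A *ᵥ χ).re ≤ U (a + b) * (star χ ⬝ᵥ χ).re)
    {ψ : Fock (Orb Λ')} {N : ℕ}
    (hψ : ∀ u', (upPart (pre (orbEmb φ) u')).card + (downPart (pre (orbEmb φ) u')).card ≠ N → ψ u' = 0) :
    (star ψ ⬝ᵥ jwEmbed (orbEmb φ) A *ᵥ ψ).re ≤ U N * (star ψ ⬝ᵥ ψ).re := by
  refine le_trans (re_form_jwEmbed_le_sum_subsectorWeight φ hA (fun a b => U (a + b)) hU ψ) ?_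
  rw [← sum_subsectorWeight φ ψ, Finset.mul_sum]
  refine le_of_eq (Finset.sum_congr rfl fun a _ => ?_)
  rw [Finset.mul_sum]
  refine Finset.sum_congr rfl fun b _ => ?_
  by_cases hab : a + b = N
  · rw [hab]
  · rw [subsectorWeight_eq_zero_of_occupation φ hψ hab, mul_zero, mul_zero]

end Subsystem

/-! ### 2. A group-local Hamiltonian is the scalar plus the sum of its embedded group restrictions -/

section Groups

variable {Λ' : Type*} [LinearOrder Λ'] [Fintype Λ']
variable {X : Type*} [Fintype X] [DecidableEq X]

omit [DecidableEq X] in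
/-- **Additivity of the second-quantised Hamiltonian in its integral tables over a finite family**, with
the scalar separated: `Ĥ(Σ_i h_i, Σ_i g_i, c) = c·1 + Σ_i Ĥ(h_i, g_i, 0)` (eq. (2.2.18) is linear in
`h`, `g`, `h_nuc`). [cite: HelgakerJorgensenOlsen2000, eq. (2.2.18)] -/
theorem molecularHamiltonian_sum_tables (hf : X → Λ' → Λ' → ℂ) (gf : X → Λ' → Λ' → Λ' → Λ' → ℂ)
    (c : ℂ) :
    molecularHamiltonian (fun p q => ∑ i, hf i p q) (fun p q r s => ∑ i, gf i p q r s) c =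
      c • (1 : Matrix (Finset (Orb Λ')) (Finset (Orb Λ')) ℂ) +
        ∑ i, molecularHamiltonian (hf i) (gf i) 0 := by
  have h1 : (∑ i, ∑ p : Λ', ∑ q : Λ', hf i p q • singletExcitation p q) =
      ∑ p : Λ', ∑ q : Λ', ∑ i, hf i p q • singletExcitation p q := by
    rw [Finset.sum_comm]
    refine Finset.sum_congr rfl fun p _ => ?_
    rw [Finset.sum_comm]
  have h2 : (∑ i, ∑ p : Λ', ∑ q : Λ', ∑ r : Λ', ∑ s : Λ',
      gf i p q r s • twoElectronExcitation p q r s) =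
      ∑ p : Λ', ∑ q : Λ', ∑ r : Λ', ∑ s : Λ', ∑ i, gf i p q r s • twoElectronExcitation p q r s := by
    rw [Finset.sum_comm]
    refine Finset.sum_congr rfl fun p _ => ?_
    rw [Finset.sum_comm]
    refine Finset.sum_congr rfl fun q _ => ?_
    rw [Finset.sum_comm]
    refine Finset.sum_congr rfl fun r _ => ?_
    rw [Finset.sum_comm]
  unfold molecularHamiltonian
  simp only [Finset.sum_smul, zero_smul, add_zero, Finset.sum_add_distrib, ← Finset.smul_sum]
  rw [h1, h2]
  abel

omit [LinearOrder Λ'] [Fintype Λ'] in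
/-- The group-`i` part of a one-electron table: `h^i_pq = h_pq` if `p` lies in group `i`, else `0`;
these parts sum to `h` (bookkeeping). [folklore] -/
private theorem sum_ite_grp_eq (grp : Λ' → X) (h : Λ' → Λ' → ℂ) (p q : Λ') :
    (∑ i, if grp p = i then h p q else 0) = h p q := by
  rw [Finset.sum_ite_eq, if_pos (Finset.mem_univ _)]

omit [LinearOrder Λ'] [Fintype Λ'] in
/-- The group parts of a two-electron table sum to it (bookkeeping). [folklore] -/
private theorem sum_ite_grp_eq₄ (grp : Λ' → X) (g : Λ' → Λ' → Λ' → Λ' → ℂ) (p q r s : Λ') :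
    (∑ i, if grp p = i then g p q r s else 0) = g p q r s := by
  rw [Finset.sum_ite_eq, if_pos (Finset.mem_univ _)]

variable (grp : Λ' → X)

/-- **Group decomposition of a group-local Hamiltonian.** If the tables are group-local for the
partition `grp` (`h_pq ≠ 0 ⇒ q ~ p`; `(pq|rs) ≠ 0 ⇒ q ~ p ∧ r ~ p ∧ s ~ p`), then
`Ĥ(h, g, c) = c·1 + Σ_i Ĥ(h^i, g^i, 0)` with `h^i`, `g^i` the parts whose FIRST index lies in group
`i` — each supported on group `i` in every index. [cite: HelgakerJorgensenOlsen2000, eq. (2.2.18)] -/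
theorem molecularHamiltonian_eq_sum_groups (h : Λ' → Λ' → ℂ) (g : Λ' → Λ' → Λ' → Λ' → ℂ) (c : ℂ) :
    molecularHamiltonian h g c =
      c • (1 : Matrix (Finset (Orb Λ')) (Finset (Orb Λ')) ℂ) +
        ∑ i, molecularHamiltonian (fun p q => if grp p = i then h p q else 0)
          (fun p q r s => if grp p = i then g p q r s else 0) 0 := by
  rw [← molecularHamiltonian_sum_tables]
  simp only [sum_ite_grp_eq, sum_ite_grp_eq₄]

variable (m : X → ℕ) (φ : ∀ i, Fin (m i) ↪o Λ')

omit [Fintype X] in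
/-- **Each group part is the Jordan–Wigner embedding of the group's own Hamiltonian.** With order
embeddings `φ i : Fin (m i) ↪o Λ'` enumerating the groups (`grp (φ i j) = i`, every orbital of group
`i` in the range of `φ i`) and group-local tables, the group-`i` part of `Ĥ(h, g, ·)` is
`jwEmbed (orbEmb (φ i)) Ĥ(h|_i, g|_i, 0)` with the RESTRICTED tables `h|_i pq = h_{φ_i p, φ_i q}`,
`g|_i pqrs = (φ_i p φ_i q | φ_i r φ_i s)` ("the operators of the subspace extended to the total space",
Verstichel et al. (2010) eqs. (22)–(23); `molecularHamiltonian_eq_jwEmbed_of_support`).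
[cite: VerstichelEtAl2010Subsystem, §2.3 eqs. (22)-(23)] -/
theorem molecularHamiltonian_grp_part_eq_jwEmbed (hφ : ∀ i j, grp (φ i j) = i)
    (hcov : ∀ i p, grp p = i → ∃ j, φ i j = p) (h : Λ' → Λ' → ℂ) (g : Λ' → Λ' → Λ' → Λ' → ℂ)
    (hh : ∀ p q, h p q ≠ 0 → grp q = grp p)
    (hg : ∀ p q r s, g p q r s ≠ 0 → grp q = grp p ∧ grp r = grp p ∧ grp s = grp p) (i : X) :
    molecularHamiltonian (fun p q => if grp p = i then h p q else 0)
        (fun p q r s => if grp p = i then g p q r s else 0) 0 =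
      jwEmbed (orbEmb (φ i)) (molecularHamiltonian (fun p q => h (φ i p) (φ i q))
        (fun p q r s => g (φ i p) (φ i q) (φ i r) (φ i s)) 0) := by
  -- an orbital lies in the range of `φ i` iff it belongs to group `i`
  have hrange : ∀ p, p ∈ Set.range (φ i) ↔ grp p = i := by
    intro p
    constructor
    · rintro ⟨j, rfl⟩
      exact hφ i j
    · intro hp
      exact hcov i p hp
  have hnot : ∀ p, p ∉ Set.range (φ i) → grp p ≠ i := fun p hp hpi => hp ((hrange p).2 hpi)
  rw [molecularHamiltonian_eq_jwEmbed_of_support (φ i) 0 (h' := fun p q => if grp p = i then h p q else 0)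
    (g' := fun p q r s => if grp p = i then g p q r s else 0)]
  · congr 1
    simp only [hφ, if_true]
  · rintro p q (hp | hq)
    · simp only [hnot p hp, if_false]
    · by_cases hpi : grp p = i
      · simp only [hpi, if_true]
        by_contra hne
        exact hnot q hq ((hh p q hne).trans hpi)
      · simp only [hpi, if_false]
  · rintro p q r s hout
    by_cases hpi : grp p = i
    · simp only [hpi, if_true]
      by_contra hne
      obtain ⟨hq, hr, hs⟩ := hg p q r s hne
      rcases hout with hp | hq' | hr' | hs'
      · exact hnot p hp hpi
      · exact hnot q hq' (hq.trans hpi)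
      · exact hnot r hr' (hr.trans hpi)
      · exact hnot s hs' (hs.trans hpi)
    · simp only [hpi, if_false]

omit [Fintype Λ'] [Fintype X] in
/-- The number of group-`i` spin orbitals of spin `σ`-part `P` (`P = upPart s` or `downPart s`) of a
configuration, counted in the group's own labels: `|P ∩ group i| = |pre-image of P under φ i|`
(bookkeeping for the occupation classes). [folklore] -/
private theorem card_filter_grp_eq_card_preimage (hφ : ∀ i j, grp (φ i j) = i)
    (hcov : ∀ i p, grp p = i → ∃ j, φ i j = p) (i : X) (P : Finset Λ') :
    (P.filter (fun p => grp p = i)).card =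
      ((Finset.univ : Finset (Fin (m i))).filter (fun j => φ i j ∈ P)).card := by
  rw [← Finset.card_map (φ i).toEmbedding]
  congr 1
  ext p
  simp only [Finset.mem_filter, Finset.mem_map, Finset.mem_univ, true_and,
    RelEmbedding.coe_toEmbedding]
  constructor
  · rintro ⟨hp, hpi⟩
    obtain ⟨j, hj⟩ := hcov i p hpi
    exact ⟨j, by rw [hj]; exact hp, hj⟩
  · rintro ⟨j, hj, rfl⟩
    exact ⟨hj, hφ i j⟩

omit [Fintype X] in
/-- The up-spin group-`i` occupation of a configuration of the full space equals the up-spin occupation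
of its pulled-back subsystem configuration (bookkeeping: `upPart (pre (orbEmb φ) s)` versus
`(upPart s) ∩ group`). [folklore] -/
private theorem card_upPart_pre_orbEmb (hφ : ∀ i j, grp (φ i j) = i) (hcov : ∀ i p, grp p = i → ∃ j, φ i j = p)
    (i : X) (s : Finset (Orb Λ')) :
    (upPart (pre (orbEmb (φ i)) s)).card = ((upPart s).filter (fun p => grp p = i)).card := by
  rw [card_filter_grp_eq_card_preimage grp m φ hφ hcov]
  congr 1
  ext j
  simp only [mem_upPart, mem_pre, orbEmb_orb, Finset.mem_filter, Finset.mem_univ, true_and]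

omit [Fintype X] in
/-- Down-spin twin of `card_upPart_pre_orbEmb`. [folklore] -/
private theorem card_downPart_pre_orbEmb (hφ : ∀ i j, grp (φ i j) = i) (hcov : ∀ i p, grp p = i → ∃ j, φ i j = p)
    (i : X) (s : Finset (Orb Λ')) :
    (downPart (pre (orbEmb (φ i)) s)).card = ((downPart s).filter (fun p => grp p = i)).card := by
  rw [card_filter_grp_eq_card_preimage grp m φ hφ hcov]
  congr 1
  ext j
  simp only [mem_downPart, mem_pre, orbEmb_orb, Finset.mem_filter, Finset.mem_univ, true_and]

/-- `⟨z, z⟩` is real: `Re(c·⟨z,z⟩) = Re c · Re⟨z,z⟩` (bookkeeping). [folklore] -/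
private theorem re_mul_star_dotProduct_self {n : Type*} [Fintype n] (c : ℂ) (z : n → ℂ) :
    (c * (star z ⬝ᵥ z)).re = c.re * (star z ⬝ᵥ z).re := by
  have him : (star z ⬝ᵥ z).im = 0 := by
    rw [dotProduct, Complex.im_sum]
    refine Finset.sum_eq_zero fun j _ => ?_
    rw [Pi.star_apply, Complex.star_def, Complex.conj_mul', ← Complex.ofReal_pow, Complex.ofReal_im]
  rw [Complex.mul_re, him, mul_zero, sub_zero]

/-- **TENSOR-BLOCK SPECTRUM LEMMA (occupation-resolved).** Let the orbitals `Λ'` be partitioned into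
groups (`grp`, enumerated by order embeddings `φ i : Fin (m i) ↪o Λ'`), let the integral tables be
group-LOCAL (`h_pq ≠ 0 ⇒ q ~ p`, `(pq|rs) ≠ 0 ⇒ q ~ p ∧ r ~ p ∧ s ~ p`), and for every group `i` let
`U_i(N)` bound the quadratic form of the group's OWN Hamiltonian `Ĥ(h|_i, g|_i, 0)` on the `(a, b)`
sectors of the group's own Fock space with `a + b = N` (a statement in dimension `4^{m i}`). Then for
every joint occupation class `l = (l_i)_i` and every vector `z` of the full Fock space supported on the
configurations with exactly `l_i` spin orbitals in group `i` for all `i`,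
`Re⟨z, Ĥ(h, g, c) z⟩ ≤ (Re c + Σ_i U_i(l_i)) · ‖z‖²`.
(The conserved-occupation block decomposition of a sum of commuting group-local operators: each group
part is the embedding of the group Hamiltonian, bounded on the class by its local top at occupation
`l_i` through the slicing of Verstichel et al. (2010) §2.3.) [cite: VerstichelEtAl2010Subsystem, §2.3 eqs. (16)-(24)] -/
theorem groupLocal_form_le (hφ : ∀ i j, grp (φ i j) = i) (hcov : ∀ i p, grp p = i → ∃ j, φ i j = p)
    (h : Λ' → Λ' → ℂ) (g : Λ' → Λ' → Λ' → Λ' → ℂ) (c : ℂ)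
    (hh : ∀ p q, h p q ≠ 0 → grp q = grp p)
    (hg : ∀ p q r s, g p q r s ≠ 0 → grp q = grp p ∧ grp r = grp p ∧ grp s = grp p)
    (U : X → ℕ → ℝ)
    (hU : ∀ i a b (χ : Fock (Orb (Fin (m i)))), IsInSector a b χ →
      (star χ ⬝ᵥ molecularHamiltonian (fun p q => h (φ i p) (φ i q))
          (fun p q r s => g (φ i p) (φ i q) (φ i r) (φ i s)) 0 *ᵥ χ).re ≤
        U i (a + b) * (star χ ⬝ᵥ χ).re)
    (l : X → ℕ) (z : Fock (Orb Λ'))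
    (hz : ∀ s, (fun i => ((upPart s).filter (fun p => grp p = i)).card +
      ((downPart s).filter (fun p => grp p = i)).card) ≠ l → z s = 0) :
    (star z ⬝ᵥ molecularHamiltonian h g c *ᵥ z).re ≤ (c.re + ∑ i, U i (l i)) * (star z ⬝ᵥ z).re := by
  have key : ∀ i, (star z ⬝ᵥ molecularHamiltonian (fun p q => if grp p = i then h p q else 0)
      (fun p q r s => if grp p = i then g p q r s else 0) 0 *ᵥ z).re ≤ U i (l i) * (star z ⬝ᵥ z).re := by
    intro i
    rw [molecularHamiltonian_grp_part_eq_jwEmbed grp m φ hφ hcov h g hh hg i]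
    refine re_form_jwEmbed_le_of_occupation (φ i)
      (fun a b χ hχ => isInSector_molecularHamiltonian_mulVec _ _ _ hχ) (U i) (hU i) ?_
    intro s hs
    refine hz s fun hl => hs ?_
    have hli := congrFun hl i
    rw [card_upPart_pre_orbEmb grp m φ hφ hcov, card_downPart_pre_orbEmb grp m φ hφ hcov, hli]
  calc (star z ⬝ᵥ molecularHamiltonian h g c *ᵥ z).re
      = c.re * (star z ⬝ᵥ z).re +
          ∑ i, (star z ⬝ᵥ molecularHamiltonian (fun p q => if grp p = i then h p q else 0)
            (fun p q r s => if grp p = i then g p q r s else 0) 0 *ᵥ z).re := by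
        rw [molecularHamiltonian_eq_sum_groups grp h g c, add_mulVec, smul_mulVec, one_mulVec,
          dotProduct_add, dotProduct_smul, smul_eq_mul, Complex.add_re, re_mul_star_dotProduct_self,
          Matrix.sum_mulVec, dotProduct_sum, Complex.re_sum]
    _ ≤ c.re * (star z ⬝ᵥ z).re + ∑ i, U i (l i) * (star z ⬝ᵥ z).re := by
        gcongr with i _
        exact key i
    _ = (c.re + ∑ i, U i (l i)) * (star z ⬝ᵥ z).re := by
        rw [add_mul, Finset.sum_mul]

/-- **The occupations of a sector vector's support sum to the particle number**: if `z s ≠ 0` for a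
vector of the `(a, b)` sector then `Σ_i (|s↑ ∩ group i| + |s↓ ∩ group i|) = a + b` (the groups
partition the orbitals — the expansion "in Slater determinants, classified according to the number
of subsystem orbitals they contain", `j + |s̄| = N`, Verstichel et al. (2010) eq. (16), applied group by
group; used to restrict the occupation table to `Σ_i l_i = a + b`).
[cite: VerstichelEtAl2010Subsystem, §2.3 eq. (16)] -/
theorem sum_grp_occupation_eq {a b : ℕ} {z : Fock (Orb Λ')} (hz : IsInSector a b z)
    {s : Finset (Orb Λ')} (hs : z s ≠ 0) :
    (∑ i, (((upPart s).filter (fun p => grp p = i)).card +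
      ((downPart s).filter (fun p => grp p = i)).card)) = a + b := by
  have hab : (upPart s).card = a ∧ (downPart s).card = b := by
    by_contra hne
    exact hs (hz s hne)
  rw [Finset.sum_add_distrib, ← Finset.card_eq_sum_card_fiberwise (fun p _ => Finset.mem_univ (grp p)),
    ← Finset.card_eq_sum_card_fiberwise (fun p _ => Finset.mem_univ (grp p)), hab.1, hab.2]

omit [Fintype X] in
/-- Each group occupation of a configuration is at most twice the group size (`|s↑ ∩ group i|`,
`|s↓ ∩ group i| ≤ m i`: a subsystem of `m` spatial orbitals holds `0 ≤ j ≤ 2m` particles, the range of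
`j` in Verstichel et al. (2010) eq. (16); used to make the occupation table finite).
[cite: VerstichelEtAl2010Subsystem, §2.3 eq. (16)] -/
theorem grp_occupation_le (hφ : ∀ i j, grp (φ i j) = i) (hcov : ∀ i p, grp p = i → ∃ j, φ i j = p)
    (i : X) (s : Finset (Orb Λ')) :
    ((upPart s).filter (fun p => grp p = i)).card + ((downPart s).filter (fun p => grp p = i)).card ≤
      2 * m i := by
  rw [card_filter_grp_eq_card_preimage grp m φ hφ hcov, card_filter_grp_eq_card_preimage grp m φ hφ hcov,
    two_mul]
  exact add_le_add ((Finset.card_filter_le _ _).trans (by rw [Finset.card_univ, Fintype.card_fin]))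
    ((Finset.card_filter_le _ _).trans (by rw [Finset.card_univ, Fintype.card_fin]))

end Groups

end Literature.MathematicalPhysics.QuantumChemistry

end
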